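import Literature.MathematicalPhysics.QuantumFieldTheory.Balaban1983to89.B11

/-!
# `Balaban1983to89.B11Prop8Assembly` — T. Bałaban, *The variational problem and background fields in renormalization group method
# for lattice gauge theories*, Commun. Math. Phys. **102** (1985) 277–309 [Balaban1985Variational], **Proposition 8** (p. 304) ASSEMBLED:
# the printed HALVING ITERATION «If ½ε₀ > B₃ε₁, then we apply again the whole reasoning with ½ε₀ instead of ε₀. We continue this way
# until we reach the bound B₃ε₁» kernel-checked as an induction over the one-step conclusion of Sect. F (pp. 300–304)

statement-level skeleton of published theorems with citation tags; proofs where landed; nothing here is a claim about the Yang–Mills mass gap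

PDF held: `paper:balaban1985-cmp102-variational-background` (journal page = PDF page + 276); p. 304 [PDF 28] read as an image by this seat
(render `run/shared/lean/pub/pub-balaban/b2b-balaban-ref1/pages/1985-cmp102-variational-background/…-p028-x2.png`).

CITATION HEADER (lean-in-tree rule 2026-08-18).  WHAT IS REPRODUCED: SKELETON row `B11.Prop8` (reader r08 `ROWS-B11.md`; decl of record
`B11.Prop8Printed B₃ fam`, B11.lean, typed-existing over the Theorem-1 carrier `B11.VarProblemX`; arithmetic of record
`B11.halving_reaches_B3eps1` «the sequence ε₀^{(n+1)} = max{B₃ε₁, ½ε₀^{(n)}} reaches B₃ε₁ after finitely many steps»).  THE PRINT (p. 304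
[PDF 28], verbatim): *"Again using the fact that U₁ is a gauge transformed U′_k on Δ₀, and that the conditions (2) are gauge invariant, we
conclude that U′_k satisfies (2) on Δ₀ with max{B₃ε₁, ½ε₀} instead of ε₀. The cube Δ₀ is an arbitrary cube Δ(y) = Bʲ(y), if y ∈ Λ_j,
hence U_k belongs to the space (2) with max{B₃ε₁, ½ε₀} instead of ε₀. If ½ε₀ ≦ B₃ε₁, then the required regularity is proved. If
½ε₀ > B₃ε₁, then we apply again the whole reasoning with ½ε₀ instead of ε₀. We continue this way until we reach the bound B₃ε₁. Let us
formulate this result in Proposition 8. There exists a positive, absolute constant a₅ such, that if U is a critical configuration of (5)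
in the space (6) with V satisfying (7), and if ε₀ ≦ a₅, then U belongs to the space (8)."*  And p. 300 [PDF 24]: *"In this section we will
prove all the regularity properties of minimal configurations U_k. We will use only the fact that they are critical configurations of the
functional (5) and that they belong to the spaces (6) with ε₀ sufficiently small."*

WHAT IS CERTIFIED (kernel, sorry-free; axioms `propext` / `Classical.choice` / `Quot.sound`).
§1 `HalvingStep P B₃ a₅` — the ONE-STEP conclusion of Sect. F ((144)–(168), pp. 300–304, with a₅ fixed by (166) and «all the previous
   restrictions on ε₀») as a located hypothesis: a critical configuration of (5) in 𝔘_k(ε₀) ∩ 𝔅_k(V), V with (7), ε₀ ≤ a₅, lies in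
   𝔘_k(max{B₃ε₁, ½ε₀}).  (Its ingredients are the rows B11.Eq144–Eq168: (152) `B11Holder9`, (155) `B11Eq155BlockLog`, (160)
   `B11Eq160BondField`, (161)–(162) `B11B3`, (165)–(168) `B11Smallness`; the assembly of the step itself is lattice-level and NOT done here.)
§2 **`inU_iterate`**: the printed iteration — from the step and the monotonicity of the spaces (2) in ε₀ (`B11.VarProblemX.Laws` (i)),
   `U ∈ 𝔘_k(max{B₃ε₁, ε₀/2ⁿ})` for every n (induction on n; the case B₃ε₁ ≥ ε₀ is monotonicity alone).
§3 **`prop8Printed_of_halvingStep : B11.Prop8Printed B₃ fam`** with THE SAME a₅, by `B11.halving_reaches_B3eps1` («until we reach the bound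
   B₃ε₁»); and the chain one level up BY NAME (`thm1Printed_of_step`: with Prop. 7 and the Sect. F conclusion, `B11.thm1_of_prop7_prop8_sectF`).

HONEST SCOPE — what is NOT claimed.  The one-step estimate (Sect. F) is the INPUT; this file certifies exactly the printed passage from the
step to Proposition 8 (the induction and its stopping rule), nothing of the lattice.  «absolute» = (d, L)-dependent (DIVERGENCE D-B11-3).
Mega-formalization `lit-balaban`, HOME `run/shared/lean/pub/lit-balaban/`, reader/typer seat r08 gen 7 (unit `lit-balaban-r08`).  Imports
`B11` only; modifies nothing.  Net new unproved facts: 0 (one hypothesis structure).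
-/

namespace Literature.MathematicalPhysics.QuantumFieldTheory.Balaban1983to89.B11Prop8Assembly

open B11

variable {I : Type}

/-! ## §1 The one-step conclusion of Sect. F as a located hypothesis -/

/-- **The halving step** (Sect. F, conclusion p. 304 [PDF 28], verbatim: *"hence U_k belongs to the space (2) with max{B₃ε₁, ½ε₀}
instead of ε₀"*, for *"critical configurations of the functional (5) … [in] the spaces (6) with ε₀ sufficiently small"* (p. 300), the
smallness being «M′ε₀ ≦ a₅» with M′ = 1 in the first case (p. 304)): for V with (7) and U critical in 𝔘_k(ε₀) ∩ 𝔅_k(V) with ε₀ ≤ a₅,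
U ∈ 𝔘_k(max{B₃ε₁, ½ε₀}).  A hypothesis of the theorems below (the lattice-level Sect. F argument (144)–(168)), never asserted.
[cite: Balaban1985Variational, Sect. F p.304 before Prop. 8] -/
structure HalvingStep (P : VarProblemX) (B₃ a₅ : ℝ) : Prop where
  step : ∀ (ε₀ ε₁ : ℝ) (V : P.Bdry) (U : P.Cfg), 0 < ε₁ → P.Reg7 ε₁ V → P.InU ε₀ U → P.InB V U →
    P.IsCritical V U → ε₀ ≤ a₅ → P.InU (max (B₃ * ε₁) (ε₀ / 2)) U

/-! ## §2 «We continue this way»: the iteration -/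

/-- Arithmetic of one more halving: `max{b, ½·max{b, ε₀/2ⁿ}} ≤ max{b, ε₀/2ⁿ⁺¹}` for b ≥ 0 (in fact equality).
[cite: Balaban1985Variational, p.304 before Prop. 8] -/
theorem max_half_le {b ε₀ : ℝ} (hb : 0 ≤ b) (n : ℕ) :
    max b (max b (ε₀ / 2 ^ n) / 2) ≤ max b (ε₀ / 2 ^ (n + 1)) := by
  refine max_le (le_max_left _ _) ?_
  rcases le_total b (ε₀ / 2 ^ n) with h | h
  · rw [max_eq_right h]
    have : ε₀ / 2 ^ n / 2 = ε₀ / 2 ^ (n + 1) := by rw [pow_succ]; ring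
    rw [this]
    exact le_max_right _ _
  · rw [max_eq_left h]
    exact le_trans (by linarith) (le_max_left _ _)

/-- The n-th stage never exceeds the starting ε₀ once B₃ε₁ ≤ ε₀ (so «all the previous restrictions on ε₀», ε₀ ≤ a₅, persist along the
iteration). [cite: Balaban1985Variational, p.304 before Prop. 8] -/
theorem stage_le {b ε₀ : ℝ} (hb : b ≤ ε₀) (hε₀ : 0 ≤ ε₀) (n : ℕ) : max b (ε₀ / 2 ^ n) ≤ ε₀ := by
  refine max_le hb ?_
  have h1 : (1 : ℝ) ≤ 2 ^ n := one_le_pow₀ (by norm_num)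
  exact div_le_self hε₀ h1

/-- **«We continue this way until we reach the bound B₃ε₁»** — the iteration: with the monotonicity of the spaces (2) in ε₀
(`(∀ e e′ U, e ≤ e′ → InU e U → InU e′ U)`, `B11.VarProblemX.Laws` (i)) and the halving step, a critical configuration U of (5) in
𝔘_k(ε₀) ∩ 𝔅_k(V) with V satisfying (7) and ε₀ ≤ a₅ lies in 𝔘_k(max{B₃ε₁, ε₀/2ⁿ}) for every n.
[cite: Balaban1985Variational, p.304 before Prop. 8] -/
theorem inU_iterate {P : VarProblemX} {B₃ a₅ : ℝ} (hB₃ : 0 ≤ B₃)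
    (mono : ∀ (e e' : ℝ) (U : P.Cfg), e ≤ e' → P.InU e U → P.InU e' U) (hstep : HalvingStep P B₃ a₅)
    {ε₀ ε₁ : ℝ} {V : P.Bdry} {U : P.Cfg} (hε₁ : 0 < ε₁) (hV : P.Reg7 ε₁ V) (hU : P.InU ε₀ U) (hB : P.InB V U)
    (hcrit : P.IsCritical V U) (ha₅ : ε₀ ≤ a₅) (n : ℕ) :
    P.InU (max (B₃ * ε₁) (ε₀ / 2 ^ n)) U := by
  have hb : 0 ≤ B₃ * ε₁ := mul_nonneg hB₃ hε₁.le
  rcases le_or_gt ε₀ (B₃ * ε₁) with hcase | hcase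
  · -- «If ½ε₀ ≦ B₃ε₁, then the required regularity is proved» — here already ε₀ ≤ B₃ε₁: monotonicity alone
    exact mono _ _ U (le_trans hcase (le_max_left _ _)) hU
  · have hε₀ : 0 ≤ ε₀ := le_trans hb hcase.le
    induction n with
    | zero => exact mono _ _ U (by simp) hU
    | succ n ih =>
      -- «we apply again the whole reasoning with ½ε₀ instead of ε₀»
      have hn : max (B₃ * ε₁) (ε₀ / 2 ^ n) ≤ a₅ := le_trans (stage_le hcase.le hε₀ n) ha₅
      have h := hstep.step _ ε₁ V U hε₁ hV ih hB hcrit hn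
      exact mono _ _ U (max_half_le hb n) h

/-! ## §3 Proposition 8 and the chain one level up -/

/-- **Proposition 8 ASSEMBLED** (p. 304, verbatim: *"There exists a positive, absolute constant a₅ such, that if U is a critical
configuration of (5) in the space (6) with V satisfying (7), and if ε₀ ≦ a₅, then U belongs to the space (8)"*): the typed statement of
record `B11.Prop8Printed B₃ fam` follows, with THE SAME a₅, from the one-step conclusion of Sect. F for every member of the family and the
monotonicity of the spaces (2) — by the iteration `inU_iterate` stopped by `B11.halving_reaches_B3eps1`.
[cite: Balaban1985Variational, Prop. 8 p.304] -/
theorem prop8Printed_of_halvingStep (fam : I → VarProblemX) {B₃ a₅ : ℝ} (hB₃ : 0 < B₃) (ha₅ : 0 < a₅)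
    (mono : ∀ (i : I) (e e' : ℝ) (U : (fam i).Cfg), e ≤ e' → (fam i).InU e U → (fam i).InU e' U)
    (hstep : ∀ i, HalvingStep (fam i) B₃ a₅) : Prop8Printed B₃ fam := by
  refine ⟨a₅, ha₅, ?_⟩
  intro i ε₀ ε₁ hε₁ V U hV hU hB hcrit hε₀
  obtain ⟨n, hn⟩ := halving_reaches_B3eps1 ε₀ (B₃ * ε₁) (mul_pos hB₃ hε₁)
  have h := inU_iterate hB₃.le (mono i) (hstep i) hε₁ hV hU hB hcrit hε₀ n
  rwa [hn] at h

/-- The chain one level up, BY NAME: Theorem 1 as printed (`B11.Thm1Printed`) from Proposition 7, the one-step conclusion of Sect. F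
(⇒ Prop. 8 by this file) and the Sect. F regularity conclusion, over the carrier dictionary `VarProblemX.Laws` — through
`B11.thm1_of_prop7_prop8_sectF`. [cite: Balaban1985Variational, Thm 1 p.279; p.304 «Now we define a₁ …»] -/
theorem thm1Printed_of_step (fam : I → VarProblemX) {B₃ C₁ a₅ : ℝ} (hB₃ : 0 < B₃) (hC₁ : 0 < C₁) (ha₅ : 0 < a₅)
    (laws : ∀ i, (fam i).Laws) (h7 : Prop7Printed B₃ C₁ fam) (hstep : ∀ i, HalvingStep (fam i) B₃ a₅)
    (hF : SectFPrinted B₃ fam) : Thm1Printed (fun i => (fam i).toVarProblem) :=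
  thm1_of_prop7_prop8_sectF fam B₃ C₁ hB₃ hC₁ laws h7
    (prop8Printed_of_halvingStep fam hB₃ ha₅ (fun i => (laws i).1) hstep) hF

end Literature.MathematicalPhysics.QuantumFieldTheory.Balaban1983to89.B11Prop8Assembly
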